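import Summits.AtomisticToContinuum.HydrodynamicLimit.Theorems.ImplosionDichotomyPolynomialCompressionStaticsLLN

/-!
# Identified `t = 0` law of large numbers for the homogeneous local Gibbs states `(1, θ₀, 0)`

Support for the crux `JParityClosure.LocalSecondLaw` (stmt-AtomisticToContinuum-13081; standing disprover's
`Cruxes/LocalSecondLaw/Disproof.lean`): for unit activity, zero drift and constant temperature `θ₀ > 0` there is
`σ₁ ∈ (0, 1/2]` such that for `0 < σ < σ₁` the local Gibbs fields converge in probability at `t = 0` to the
CONSTANT fields `(1, 0, θ₀)` through every flow family (`homogeneous_lln_identified`).  The tree's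
`stub_staticsLLN` gives the limit density `rhoLim (profileOf 1) σ`, constant in `x` for constant activity; it is
`= 1` because the empirical density of the test function `1` is identically `1` (`empiricalDensityField_one`)
on the `Φ.good`-a.s. set where `Φ₀ = id`, and limits in probability are unique.  This is the matched-data input
of every equilibrium witness in `LocalSecondLaw/Negative/`.  refuter-cdisprove-stmt-AtomisticToContinuum-13081-0.
-/

noncomputable section

namespace Summit.AtomisticToContinuum.HydrodynamicLimit.Theorems.LocalSecondLawNegative

open MeasureTheory Filter Set Topology
open scoped ENNReal
open Literature.MathematicalPhysics.KineticTheory Literature.Analysis.FluidPDE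

variable {N : ℕ}

/-- **Identified `t = 0` LLN for the homogeneous state `(1, θ₀, 0)`**: for `0 < σ < σ₁` the local Gibbs
fields converge to the constant fields `(1, 0, θ₀)` through every flow family (`stub_staticsLLN` gives
the constant `rhoLim`; `= 1` by `empiricalDensityField_one` and `Φ.good` a.s.). [folklore] -/
theorem homogeneous_lln_identified {θ₀ : ℝ} (hθ₀ : 0 < θ₀) :
    ∃ σ₁ : ℝ, 0 < σ₁ ∧ σ₁ ≤ 1 / 2 ∧ ∀ σ : ℝ, 0 < σ → σ < σ₁ →
      ∀ Φ : (N : ℕ) → HardSphereFlow (Torus.geometry (Fin 3)) (hsDiameter σ N) (N + 1),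
        TendstoHydroFieldsAt (fun N => localGibbsLaw σ (fun _ => 1) (fun _ => 0) (fun _ => θ₀) N (Φ N)) Φ
          (fun _ _ => (1 : ℝ)) (fun _ _ => (0 : V3)) (fun _ _ => θ₀) 0 := by
  have hc1 : Continuous (fun _ : T3 => (1 : ℝ)) := continuous_const
  have hcθ : Continuous (fun _ : T3 => θ₀) := continuous_const
  have hc0 : Continuous (fun _ : T3 => (0 : V3)) := continuous_const
  obtain ⟨σ₁, hσ₁, hS⟩ := stub_staticsLLN
    (fun _ => 1) (fun _ => θ₀) (fun _ => 0) hc1 hcθ hc0 (fun _ => one_pos) (fun _ => hθ₀)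
  refine ⟨min σ₁ (1 / 2), lt_min hσ₁ (by norm_num), min_le_right _ _, fun σ hσpos hσlt Φ => ?_⟩
  have hσlt1 : σ < σ₁ := lt_of_lt_of_le hσlt (min_le_left _ _)
  have hσhalf' : σ ≤ 1 / 2 := (lt_of_lt_of_le hσlt (min_le_right _ _)).le
  have hprob : ∀ N, IsProbabilityMeasure (localGibbsLaw σ (fun _ => 1) (fun _ => 0) (fun _ => θ₀) N (Φ N)) :=
    fun N => isProbabilityMeasure_localGibbsLaw hc1 hcθ hc0 (fun _ => one_pos) (fun _ => hθ₀)
      hσhalf' N (Φ N)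
  obtain ⟨-, -, hTΦ⟩ := hS σ hσpos hσlt1
  have hT := hTΦ Φ
  set P := profileOf (fun _ : T3 => (1 : ℝ)) hc1 (fun _ => one_pos) with hP
  have hconst : ∀ y, rhoLim P σ y = rhoLim P σ 0 := fun y => by
    simp only [rhoLim, hP, profileOf_β]
  have hκ : rhoLim P σ 0 = 1 := by
    by_contra hne
    have hk : 0 < |1 - rhoLim P σ 0| := abs_pos.2 (sub_ne_zero.2 (Ne.symm hne))
    have hd := (hT (fun _ => 1) continuous_const (|1 - rhoLim P σ 0| / 2) (by positivity)).1
    have hint : ∫ x : T3, (fun _ : T3 => (1 : ℝ)) x * (fun _ : ℝ => rhoLim P σ) 0 x = rhoLim P σ 0 := by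
      show ∫ x : T3, (1 : ℝ) * rhoLim P σ x = rhoLim P σ 0
      simp_rw [one_mul, hconst]
      simp
    have hone : ∀ N, (1 : ℝ≥0∞) ≤ localGibbsLaw σ (fun _ => 1) (fun _ => 0) (fun _ => θ₀) N (Φ N)
        {z | |1 - rhoLim P σ 0| / 2 < |empiricalDensityField ((Φ N).flow 0 z) (fun _ => 1) -
          ∫ x : T3, (fun _ : T3 => (1 : ℝ)) x * (fun _ : ℝ => rhoLim P σ) 0 x|} := by
      intro N
      haveI := hprob N
      have hac : localGibbsLaw σ (fun _ => 1) (fun _ => 0) (fun _ => θ₀) N (Φ N) ≪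
          liouville (Torus.geometry (Fin 3)) (N + 1) (hsDiameter σ N) :=
        withDensity_absolutelyContinuous _ _
      have hg : ∀ᵐ z ∂(localGibbsLaw σ (fun _ => 1) (fun _ => 0) (fun _ => θ₀) N (Φ N)),
          z ∈ (Φ N).good := hac.ae_le (Φ N).ae_mem_good
      rw [← measure_univ (μ := localGibbsLaw σ (fun _ => 1) (fun _ => 0) (fun _ => θ₀) N (Φ N))]
      refine measure_mono_ae ?_
      filter_upwards [hg] with z hz _
      show |1 - rhoLim P σ 0| / 2 < |empiricalDensityField ((Φ N).flow 0 z) (fun _ => 1) -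
        ∫ x : T3, (fun _ : T3 => (1 : ℝ)) x * (fun _ : ℝ => rhoLim P σ) 0 x|
      rw [(Φ N).flow_zero z hz, empiricalDensityField_one (Nat.succ_ne_zero N), hint]
      exact half_lt_self hk
    have h10 : (1 : ℝ≥0∞) ≤ 0 := ge_of_tendsto' hd hone
    exact absurd h10 (by simp)
  have hρ : (fun (_ : ℝ) => rhoLim P σ) = fun (_ : ℝ) (_ : T3) => (1 : ℝ) := by
    funext t x; rw [hconst x, hκ]
  rw [hρ] at hT
  exact hT


end Summit.AtomisticToContinuum.HydrodynamicLimit.Theorems.LocalSecondLawNegative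

end
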